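import Literature.MathematicalPhysics.QuantumFieldTheory.Balaban1983to89.B15RegularSpaces164

/-!
# `Balaban1983to89.B15Space164Descent` — T. Bałaban, *Large field renormalization. I. The basic step of the 𝐑 operation*,
Commun. Math. Phys. **122** (1989) 175–202 [Balaban1989LargeFieldI], p. 191: «They form a descending sequence for increasing n,
if β and L₀ satisfy certain conditions, for example if β ≤ 1/4 and L₀² ≤ (1/3)L» — PROVED as the SET INCLUSION
`Ũ^{(n+1)c}_k(X, α̃₀, α̃₁) ⊆ Ũ^{(n)c}_k(X, α̃₀, α̃₁)` of the typed spaces `B15RegularSpaces164.space164`, the two levels' printed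
region and cube families being related by print's index ranges read as inclusions of index sets (`Nested`)

HONEST FRAMING (cell `lit-balaban`, verbatim): statement-level skeleton of published theorems with citation tags; proofs where landed; nothing here is a claim about the Yang–Mills mass gap.

PDF held: `paper:balaban1989-cmp122-large-field-i` (journal page = PDF page + 174); pp. 190–191 read from the page renders
`b2b-balaban-ref1/pages/1989-cmp122-large-field-I/1989-cmp122-large-field-I-p016-x2.png` / `…-p017-x2.png` and the text layer p0017.

WHAT IS REPRODUCED.  Cells for SKELETON row `B15.Claim@191` (p. 191 remarks; class D — the head is the owner's): the sentence
*«They form a descending sequence for increasing n, if β and L₀ satisfy certain conditions, for example if β ≦ 1/4 and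
L₀² ≦ (1/3)L. Notice that we get the stronger restriction on L₀ because of the bounds for A′.»* for the sets of
`B15RegularSpaces164` (row `B15.Eq1.64–1.69`, p29 gen 42), with the clause-to-clause arithmetic of `B15.ComplexSpaces` Part C
(unit `b2b-balaban-b01`: `clause164_interior`, `clause168_upper`, `clause168_deep`, `clause166_creation`, `clause164_creation_top`,
`cube165_rescale`) consumed BY NAME at the error `α = 0` of its (1.48)-model (`Ineq148 q q 0 β s E`, i.e. the map `T = id` of
`B15.ComplexSpaces.Descends`).  What THIS file adds is exactly the two items that docstring lists as NOT CERTIFIED: «(b) the region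
bookkeeping Ω″_1 ⊃ ⋯ ⊃ Ω″_{j+1} ⊃ Ω_{k₀+1} ⊃ ⋯ ⊃ Ω_k read off the printed ranges, which pairs the clauses as
INTERIOR/UPPER/DEEP/CREATION» and, of (d), «that a level-n cube of size CML^jη lies in a level-(n+1) cube of size CML^{j+1}η of the
admissible family» — both as LOCATED HYPOTHESES on the pair of frames (the Prop-structure `Nested`), after which the descent is a
theorem about the typed sets.

THE PRINT (pp. 190–191; the full text of (1.64)–(1.69) is quoted in `B15RegularSpaces164`).  Level `n` (`j = h + n`): (i) rungs
`m = 1, …, j` on `(Ω″_m∖Ω″_{m+1})∩X` (`m < j`), `(Ω″_j∖Ω_{k₀+1})∩X` (`m = j`), factor `(1 − βΣ_{i=h+1}^{j}2^{−|m−i|} −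
βΣ_{q=m+1}^{k}2^{−(q−m)})L₀^{2max{0,m−k₀}}`, units at scale `m`, cubes (1.65) «□ ⊂ Ω″_m, □∩Ω″^c_{m+1} ≠ ∅ …, □ ⊂ Ω″_j,
□∩Ω^c_{k₀+1} ≠ ∅ if m = j, □ is of the size CML^mη»; (ii) shells `m = k₀+1, …, j` on `(Ω_m∖Ω_{m+1})∩X`, the DIAGONAL factor times
`L₀^{2(j−m)}`, units at scale `j`, cubes (1.67) «□ ⊂ Ω_m, □∩Ω^c_{m+1} ≠ ∅, □ is of the size CML^jη»; (iii) rungs `m = j+1, …, k` on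
`(Ω_m∖Ω_{m+1})∩X` / `Ω_k∩X`, factor `·c`, units at scale `m`, cubes (1.69) «□ ⊂ Ω_m, □∩Ω^c_{m+1} ≠ ∅ …, of the size CML^mη», no
weight.  p. 191: *«For j ≦ k₀ it is simpler, there are no powers of L₀ in the point (i), and the point (ii) is empty.»*

THE TYPING.  (a) The two levels share «X», «U_{p,X}(M˙(𝕌))», «J_{p,X}(M˙(𝕌))» and their lattices: `Shared` = `(X, lvl, Up, Jp)`;
the level-dependent data are the nine printed region / cube families: `Layers S` (`layerI/cubesI/layerII/cubesII/layerIII/cubesIII`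
in the `η`-lattice, `player/playerII/playerIII` in the lattices of `U_{p,X}`); `frameOf S R : CFrame` rebuilds the gen-42 frame, and
EVERY `CFrame` is of this form (`frameOf_ofFrame`).  READING made explicit: print's `U_{p,X}(M˙(𝕌)) = U(𝔹_p(X)∪{Γ_i^{(n)}}_{i<p}, M˙(𝕌))`
carries the level `n` through the determining sets `{Γ_i^{(n)}}`; the descent sentence compares the BOUNDS only, and so does this
file — the functions are the shared data `Up`, `Jp` of both levels (their `n`-dependence is the «stronger statement» of p. 191,
not touched here).  (b) `succC c` = the constants of level `n+1` (`j ↦ j+1`, all else equal).  (c) `RSub`, `RCovers` = inclusion /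
covering of the three index sets of `B12RegularSpaces111.Region` (plaquettes, bonds, derivative triples — regions are data, F5).
(d) **`Nested c R′ R`** = print's ranges as index-set inclusions between the level-`(n+1)` families `R′` and the level-`n` families
`R`: (i) rungs `m < j`: the same layer `(Ω″_m∖Ω″_{m+1})∩X` and cubes; rung `j`: `(Ω″_j∖Ω_{k₀+1}) ⊆ (Ω″_j∖Ω″_{j+1}) ∪
(Ω″_{j+1}∖Ω_{k₀+1})` (set algebra), a rung-`j` cube being a rung-`j` cube of level `n+1` or contained in a
rung-`(j+1)` cube of level `n+1`; (ii) shells: the same layer `(Ω_m∖Ω_{m+1})∩X`, each cube «of the size CML^jη» inside one «of the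
size CML^{j+1}η»; (iii) rungs `m ≥ j+2`: the same; rung `j+1`: the layer `(Ω_{j+1}∖Ω_{j+2})∩X` and its cubes are the level-`(n+1)`
shell `j+1` of (ii) when `k₀+1 ≤ j+1`, and lie in the level-`(n+1)` rung `j+1` of (i) (`(Ω″_{j+1}∖Ω_{k₀+1}) ⊇ (Ω_{j+1}∖Ω_{j+2})`)
when `j+1 ≤ k₀` («the point (ii) is empty»).

PROVED.  Unit rescaling `scale j+1 → j`: each of the seven printed units at scale `s+1` with coefficient `α_{·,s+1} ≤ ρα_{·,s}` is
`≤ (ρ/L)·` the unit at scale `s` (`uPlaq_succ`, …, `unit_succ_le`; the `|A′|` unit `α_{1,s}(L^sη)^{−1}` rescales by EXACTLY `L^{−1}`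
— print's «stronger restriction on L₀ because of the bounds for A′»); the five rung-level steps `rung_interior` (factor `j+1 ↦ j`
at a rung `m ≤ j`), `rung_creation_top` ((i) rung `j+1` of level `n+1` ⇒ (i) rung `j` of level `n`), `rung_creationII` ((ii) shell
`m`, units `j+1 ↦ j`, weight `L₀^{2(j+1−m)} = L₀²L₀^{2(j−m)}`), `rung_upper` ((ii) shell `j+1` / (i) rung `j+1` of level `n+1` ⇒ (iii)
rung `j+1` of level `n`), `rung_deep`; `rung_of_covers` (a rung on a covered region); **`satisfies164_descent`** and
**`space164_descent`**: `space164 𝓜 (frameOf S R′) (succC c) α̃₀ α̃₁ ⊆ space164 𝓜 (frameOf S R) c α̃₀ α̃₁` under `Nested c R′ R`,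
`h ≤ j`, `j+1 ≤ k`, `0 ≤ β ≤ 1/4`, `1 ≤ L`, `1 ≤ L₀`, `η > 0`, `BCM ≥ 0`, nonnegative sequences with `α_{·,j+1} ≤ ρα_{·,j}`, `ρ ≥ 0`,
and the creation condition of `B15.ComplexSpaces` at `α = 0` in the located form `L₀²ρ/L ≤ κ ≤ 1`, `β/2 ≤ (1−κ)(1−2β)`;
**`space164_descent_printed`**: the same under print's «β ≤ 1/4 and L₀² ≤ (1/3)L» with `1 ≤ L₀` and growth ratio `ρ ≤ 9/4`
(`κ = 3/4`); `descends_id` = the same in the shape `B15.ComplexSpaces.Descends … id`; §7 **`space164_descent_chain`**: along a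
sequence of level frames `Rs n` with `Nested (levelC c n) (Rs (n+1)) (Rs n)` the spaces decrease, `Ũ^{(n+d)c}_k ⊆ Ũ^{(n)c}_k` while
`j + 1 ≤ k` (`levelC c n` = the constants of level `n`, `j ↦ j + n`); §8 `lower c R′` = the LARGEST level-`n` families the bookkeeping
allows below given level-`(n+1)` families and `nested_lower : Nested c R′ (lower c R′)` («(ours)» consistency witness of the hypotheses).
HONEST SCOPE.  (1) `T = id` only; the «stronger statement» for `exp iηℍ^{(n)}_k(…)𝕌` and its error model stay as in
`B15.ComplexSpaces` (NOT CERTIFIED (a), (e) there).  (2) Regions, cubes and the functions `U_{p,X}`, `J_{p,X}` are data; `Nested` is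
the located reading of print's ranges — an instance from concrete nested sequences `{Ω″_m}`, `{Ω_m}` and cube partitions is not
built here.  (3) The growth ratio `ρ` of `α̃₀, α̃₁` is a hypothesis (print: «certain conditions»; `B15.ComplexSpaces` Part E bounds it
under [III] (2.28)); the thresholds `9/4`, `3/4` are arithmetic of this reading, not printed.  No `Prop` placeholder, no new fact;
axioms standard.  Unit `lit-balaban-p29` (Phase-2 seat p29 gen 43; TAKING line HOME/STATUS.md 2026-08-25T05:23:01Z), HOME
`run/shared/lean/pub/lit-balaban/`.
-/

namespace Literature.MathematicalPhysics.QuantumFieldTheory.Balaban1983to89.B15Space164Descent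

open Literature.MathematicalPhysics.QuantumFieldTheory.Balaban1983to89
open Literature.MathematicalPhysics.QuantumFieldTheory.Balaban1983to89.B12RegularSpaces111
open Literature.MathematicalPhysics.QuantumFieldTheory.Balaban1983to89.B14RegularSpaces234
open Literature.MathematicalPhysics.QuantumFieldTheory.Balaban1983to89.B15.ComplexSpaces
open Literature.MathematicalPhysics.QuantumFieldTheory.Balaban1983to89.B15.BasicStep (lfFactor Ineq148)
open Literature.MathematicalPhysics.QuantumFieldTheory.Balaban1983to89.B15RegularSpaces164
open Complex

noncomputable section

/-! ## §1. Index-set inclusions of regions; the constants of the next level -/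

section Regions

variable {P : Params} {i : ℕ}

/-- `R ⊆ R′` for regions-as-index-sets: every plaquette, bond and derivative triple of `R` is one of `R′` (how «on (Ω″_j∖Ω″_{j+1})∩X»
lies inside «on (Ω″_j∖Ω_{k₀+1})∩X» is read; regions are data, F5). [cite: Balaban1989LargeFieldI, (1.64) p.190] -/
def RSub (R R' : Region P i) : Prop :=
  R.plaqs ⊆ R'.plaqs ∧ R.bonds ⊆ R'.bonds ∧ R.dpairs ⊆ R'.dpairs

/-- `R ⊆ R₁ ∪ R₂` for regions-as-index-sets (how «(Ω″_j∖Ω_{k₀+1}) = (Ω″_j∖Ω″_{j+1}) ∪ (Ω″_{j+1}∖Ω_{k₀+1})» is read, plaquette by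
plaquette, bond by bond, derivative triple by derivative triple). [cite: Balaban1989LargeFieldI, (1.64) p.190] -/
def RCovers (R R₁ R₂ : Region P i) : Prop :=
  R.plaqs ⊆ R₁.plaqs ∪ R₂.plaqs ∧ R.bonds ⊆ R₁.bonds ∪ R₂.bonds ∧ R.dpairs ⊆ R₁.dpairs ∪ R₂.dpairs

/-- `RSub` is reflexive (API of the index-set reading). [cite: Balaban1989LargeFieldI, (1.64) p.190] -/
theorem rsub_refl (R : Region P i) : RSub R R := ⟨subset_rfl, subset_rfl, subset_rfl⟩

/-- `RSub` is transitive (API of the index-set reading). [cite: Balaban1989LargeFieldI, (1.64) p.190] -/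
theorem rsub_trans {R R' R'' : Region P i} (h : RSub R R') (h' : RSub R' R'') : RSub R R'' :=
  ⟨h.1.trans h'.1, h.2.1.trans h'.2.1, h.2.2.trans h'.2.2⟩

/-- A sub-region is covered by its super-region and anything (API of the index-set reading). [cite: Balaban1989LargeFieldI, (1.64) p.190] -/
theorem rcovers_of_rsub_left {R R₁ : Region P i} (h : RSub R R₁) (R₂ : Region P i) : RCovers R R₁ R₂ :=
  ⟨fun _ hq => Or.inl (h.1 hq), fun _ hb => Or.inl (h.2.1 hb), fun _ hq => Or.inl (h.2.2 hq)⟩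

/-- A sub-region is covered by anything and its super-region (API of the index-set reading). [cite: Balaban1989LargeFieldI, (1.64) p.190] -/
theorem rcovers_of_rsub_right {R R₂ : Region P i} (h : RSub R R₂) (R₁ : Region P i) : RCovers R R₁ R₂ :=
  ⟨fun _ hq => Or.inr (h.1 hq), fun _ hb => Or.inr (h.2.1 hb), fun _ hq => Or.inr (h.2.2 hq)⟩

end Regions

/-- The constants of the NEXT level: `n ↦ n+1` is `j = h + n ↦ j + 1`; `k, h, k₀, η, L, L₀, β, B, C, M` unchanged («for increasing n»).
[cite: Balaban1989LargeFieldI, p.191] -/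
def succC (c : CConsts) : CConsts where
  k := c.k
  h := c.h
  j := c.j + 1
  k₀ := c.k₀
  η := c.η
  L := c.L
  L₀ := c.L₀
  β := c.β
  B := c.B
  C := c.C
  M := c.M

/-- `(succC c).j = j + 1`. [cite: Balaban1989LargeFieldI, p.191] -/
@[simp] theorem succC_j (c : CConsts) : (succC c).j = c.j + 1 := rfl

/-- The [III]/[I] constants underlying the factorisation `𝕌 = (exp iηA′)U` do not see `j`. [cite: Balaban1989LargeFieldI, p.191] -/
theorem succC_toMSConsts (c : CConsts) : (succC c).toMSConsts = c.toMSConsts := rfl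

/-! ## §2. The shared data of the two levels and the level-dependent region families -/

section Frames

variable {P : Params} {i : ℕ} {𝔸 : Type*}

/-- What the spaces of two consecutive levels SHARE: «defined on X», and the functions «U_{p,X}(M˙(𝕌))», «J_{p,X}(M˙(𝕌))» with their
lattices (data, as in `B14RegularSpaces234.MSBackgroundFns`; see the module docstring, READING, for their printed `n`-dependence).
[cite: Balaban1989LargeFieldI, (1.64) p.190] -/
structure Shared (P : Params) (i : ℕ) (𝔸 : Type*) [Monoid 𝔸] where
  /-- the localization domain `X` -/
  X : Region P i
  /-- the lattice level carrying `U_{p,X}`, `J_{p,X}` -/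
  lvl : ℕ → ℕ
  /-- `𝕌 ↦ U_{p,X}(M˙(𝕌))` -/
  Up : (p : ℕ) → (PBond P i → 𝔸ˣ) → PBond P (lvl p) → 𝔸ˣ
  /-- `𝕌 ↦ J_{p,X}(M˙(𝕌))` -/
  Jp : (p : ℕ) → (PBond P i → 𝔸ˣ) → PBond P (lvl p) → 𝔸

/-- What DEPENDS ON THE LEVEL `n`: the nine printed region / cube families of (1.64)–(1.69) — (i) `m ↦ (Ω″_m∖Ω″_{m+1})∩X`,
`(Ω″_j∖Ω_{k₀+1})∩X` and its cubes (1.65); (ii) `m ↦ (Ω_m∖Ω_{m+1})∩X` and its cubes (1.67); (iii) `m ↦ (Ω_m∖Ω_{m+1})∩X`, `Ω_k∩X` and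
its cubes (1.69); and the three families in the lattices of `U_{p,X}`. [cite: Balaban1989LargeFieldI, (1.64)-(1.69) pp.190–191] -/
structure Layers [Monoid 𝔸] (S : Shared P i 𝔸) where
  /-- (i): the layer of rung `m` -/
  layerI : ℕ → Region P i
  /-- (1.65): the cube regions `□∩X` of rung `m` -/
  cubesI : ℕ → Set (Region P i)
  /-- (ii): the shell `m` -/
  layerII : ℕ → Region P i
  /-- (1.67): the cube regions of shell `m` -/
  cubesII : ℕ → Set (Region P i)
  /-- (iii): the layer of rung `m` -/
  layerIII : ℕ → Region P i
  /-- (1.69): the cube regions of rung `m` -/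
  cubesIII : ℕ → Set (Region P i)
  /-- (i) in the lattice of `U_{p,X}`: `(p, m) ↦` the layer of rung `m` -/
  player : (p m : ℕ) → Region P (S.lvl p)
  /-- (ii) in the lattice of `U_{p,X}` -/
  playerII : (p m : ℕ) → Region P (S.lvl p)
  /-- (iii) in the lattice of `U_{p,X}` -/
  playerIII : (p m : ℕ) → Region P (S.lvl p)

/-- The frame of `B15RegularSpaces164` assembled from the shared data and one level's families.
[cite: Balaban1989LargeFieldI, (1.64)-(1.69) pp.190–191] -/
abbrev frameOf [Monoid 𝔸] (S : Shared P i 𝔸) (R : Layers S) : CFrame P i 𝔸 where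
  X := S.X
  layerI := R.layerI
  cubesI := R.cubesI
  layerII := R.layerII
  cubesII := R.cubesII
  layerIII := R.layerIII
  cubesIII := R.cubesIII
  bg :=
    { lvl := S.lvl
      Up := S.Up
      Jp := S.Jp
      layer := R.player
      layerII := R.playerII
      layerIII := R.playerIII }

/-- The shared part of a frame. [cite: Balaban1989LargeFieldI, (1.64) p.190] -/
def sharedOf [Monoid 𝔸] (F : CFrame P i 𝔸) : Shared P i 𝔸 where
  X := F.X
  lvl := F.bg.lvl
  Up := F.bg.Up
  Jp := F.bg.Jp

/-- The level-dependent part of a frame. [cite: Balaban1989LargeFieldI, (1.64)-(1.69) pp.190–191] -/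
def layersOf [Monoid 𝔸] (F : CFrame P i 𝔸) : Layers (sharedOf F) where
  layerI := F.layerI
  cubesI := F.cubesI
  layerII := F.layerII
  cubesII := F.cubesII
  layerIII := F.layerIII
  cubesIII := F.cubesIII
  player := F.bg.layer
  playerII := F.bg.layerII
  playerIII := F.bg.layerIII

/-- EVERY frame of `B15RegularSpaces164` is `frameOf` of its shared and level-dependent parts (so the descent theorem below speaks about
all pairs of frames with the same `X`, `U_{p,X}`, `J_{p,X}`). [cite: Balaban1989LargeFieldI, (1.64)-(1.69) pp.190–191] -/
theorem frameOf_ofFrame [Monoid 𝔸] (F : CFrame P i 𝔸) : frameOf (sharedOf F) (layersOf F) = F := rfl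

end Frames

/-! ## §3. The located region / cube bookkeeping between level `n+1` and level `n` -/

section NestedDef

variable {P : Params} {i : ℕ} {𝔸 : Type*} [Monoid 𝔸]

/-- **Print's ranges as index-set inclusions** between the families `R′` of level `n+1` (`j+1`) and `R` of level `n` (`j`), read off
«(Ω″_m∖Ω″_{m+1})∩X for m = 1,…,j−1, and on (Ω″_j∖Ω_{k₀+1})∩X for m = j», «(Ω_m∖Ω_{m+1})∩X for m = k₀+1,…,j», «(Ω_m∖Ω_{m+1})∩X
for m = j+1,…,k−1, and on Ω_k∩X for m = k», the cube sentences of (1.65)/(1.67)/(1.69) and the nesting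
`Ω″_1 ⊃ ⋯ ⊃ Ω″_{j+1} ⊃ Ω_{k₀+1} ⊃ ⋯ ⊃ Ω_k`, `Ω_m ⊂ Ω″_m` ([III] (2.1), (1.12)): (i) rungs `m < j` unchanged; the rung-`j` layer of
level `n` is covered by the rungs `j`, `j+1` of level `n+1` (`(Ω″_j∖Ω_{k₀+1}) = (Ω″_j∖Ω″_{j+1}) ∪ (Ω″_{j+1}∖Ω_{k₀+1})`, set algebra),
its cubes being rung-`j` cubes of level `n+1` or contained in rung-`(j+1)` cubes of level
`n+1`; (ii) shells unchanged, each cube «of the size CML^jη» inside a cube «of the size CML^{j+1}η» of the same shell; (iii) rungs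
`m ≥ j+2` unchanged; the rung `j+1` of level `n` is the shell `j+1` of (ii) at level `n+1` if `k₀+1 ≤ j+1`, and lies in the rung `j+1`
of (i) at level `n+1` if `j+1 ≤ k₀` («the point (ii) is empty»). Geometry is data: these are HYPOTHESES on the two frames.
[cite: Balaban1989LargeFieldI, (1.64)-(1.69) pp.190–191] -/
structure Nested (c : CConsts) {S : Shared P i 𝔸} (R' R : Layers S) : Prop where
  /-- (i), `m < j`: the same layer -/
  subI : ∀ m, 1 ≤ m → m < c.j → RSub (R.layerI m) (R'.layerI m)
  /-- (i), `m < j`: the same layer in the lattices of `U_{p,X}` -/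
  subIp : ∀ m, 1 ≤ m → m < c.j → ∀ p, RSub (R.player p m) (R'.player p m)
  /-- (1.65), `m < j`: the same cubes -/
  cubesI : ∀ m, 1 ≤ m → m < c.j → R.cubesI m ⊆ R'.cubesI m
  /-- (i), `m = j`: `(Ω″_j∖Ω_{k₀+1})∩X ⊆ (Ω″_j∖Ω″_{j+1})∩X ∪ (Ω″_{j+1}∖Ω_{k₀+1})∩X` -/
  topI : RCovers (R.layerI c.j) (R'.layerI c.j) (R'.layerI (c.j + 1))
  /-- (i), `m = j`, in the lattices of `U_{p,X}` -/
  topIp : ∀ p, RCovers (R.player p c.j) (R'.player p c.j) (R'.player p (c.j + 1))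
  /-- (1.65), `m = j`: a cube `□ ⊂ Ω″_j` meeting `Ω^c_{k₀+1}` of size `CML^jη` either meets `Ω″^c_{j+1}` (a rung-`j` cube of level `n+1`)
  or lies in a cube `⊂ Ω″_{j+1}` of size `CML^{j+1}η` meeting `Ω^c_{k₀+1}` -/
  cubesTopI : ∀ D ∈ R.cubesI c.j, D ∈ R'.cubesI c.j ∨ ∃ D' ∈ R'.cubesI (c.j + 1), RSub D D'
  /-- (ii): the same shell `(Ω_m∖Ω_{m+1})∩X`, `m = k₀+1, …, j` -/
  subII : ∀ m, c.k₀ + 1 ≤ m → m ≤ c.j → RSub (R.layerII m) (R'.layerII m)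
  /-- (ii) in the lattices of `U_{p,X}` -/
  subIIp : ∀ m, c.k₀ + 1 ≤ m → m ≤ c.j → ∀ p, RSub (R.playerII p m) (R'.playerII p m)
  /-- (1.67): a cube of shell `m` «of the size CML^jη» lies in a cube of shell `m` «of the size CML^{j+1}η» -/
  cubesII : ∀ m, c.k₀ + 1 ≤ m → m ≤ c.j → ∀ D ∈ R.cubesII m, ∃ D' ∈ R'.cubesII m, RSub D D'
  /-- (iii), `m ≥ j+2`: the same layer -/
  subIII : ∀ m, c.j + 2 ≤ m → m ≤ c.k → RSub (R.layerIII m) (R'.layerIII m)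
  /-- (iii), `m ≥ j+2`, in the lattices of `U_{p,X}` -/
  subIIIp : ∀ m, c.j + 2 ≤ m → m ≤ c.k → ∀ p, RSub (R.playerIII p m) (R'.playerIII p m)
  /-- (1.69), `m ≥ j+2`: the same cubes -/
  cubesIII : ∀ m, c.j + 2 ≤ m → m ≤ c.k → R.cubesIII m ⊆ R'.cubesIII m
  /-- (iii), `m = j+1`, case `k₀+1 ≤ j+1`: the layer is the shell `j+1` of (ii) at level `n+1` -/
  upII : c.k₀ + 1 ≤ c.j + 1 → RSub (R.layerIII (c.j + 1)) (R'.layerII (c.j + 1))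
  /-- the same in the lattices of `U_{p,X}` -/
  upIIp : c.k₀ + 1 ≤ c.j + 1 → ∀ p, RSub (R.playerIII p (c.j + 1)) (R'.playerII p (c.j + 1))
  /-- (1.69) at `m = j+1` IS (1.67) at the shell `j+1` of level `n+1` («□ ⊂ Ω_m, □∩Ω^c_{m+1} ≠ ∅, of the size CML^{j+1}η») -/
  cubesUpII : c.k₀ + 1 ≤ c.j + 1 → R.cubesIII (c.j + 1) ⊆ R'.cubesII (c.j + 1)
  /-- (iii), `m = j+1`, case `j+1 ≤ k₀`: `(Ω_{j+1}∖Ω_{j+2})∩X ⊆ (Ω″_{j+1}∖Ω_{k₀+1})∩X`, the rung `j+1` of (i) at level `n+1` -/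
  upI : c.j + 1 ≤ c.k₀ → RSub (R.layerIII (c.j + 1)) (R'.layerI (c.j + 1))
  /-- the same in the lattices of `U_{p,X}` -/
  upIp : c.j + 1 ≤ c.k₀ → ∀ p, RSub (R.playerIII p (c.j + 1)) (R'.player p (c.j + 1))
  /-- (1.69) at `m = j+1` ⊆ (1.65) at the rung `j+1` of level `n+1` («□ ⊂ Ω_{j+1} ⊂ Ω″_{j+1}», «□∩Ω^c_{j+2} ≠ ∅ ⇒ □∩Ω^c_{k₀+1} ≠ ∅») -/
  cubesUpI : c.j + 1 ≤ c.k₀ → R.cubesIII (c.j + 1) ⊆ R'.cubesI (c.j + 1)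

end NestedDef

/-! ## §4. The seven units under `scale s+1 ↦ s` («the stronger restriction on L₀ because of the bounds for A′») -/

section Units

/-- `(L^{s+1}η)^{−n} = L^{−n}·(L^sη)^{−n}`. [folklore] -/
private theorem pow_succ_mul_zpow (L η : ℝ) (s : ℕ) (n : ℤ) : (L ^ (s + 1) * η) ^ n = L ^ n * (L ^ s * η) ^ n := by
  rw [pow_succ, show L ^ s * L * η = L * (L ^ s * η) by ring, mul_zpow]

/-- `α η²(L^{s+1}η)^{−2} = L^{−2}·α η²(L^sη)^{−2}`. [cite: Balaban1989LargeFieldI, (1.64) p.190] -/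
theorem uPlaq_succ (a η L : ℝ) (s : ℕ) : uPlaq a η L (s + 1) = L ^ (-2 : ℤ) * uPlaq a η L s := by
  unfold uPlaq; rw [pow_succ_mul_zpow]; ring

/-- `α L^{−2p}(L^{s+1}L^{−p})^{−2} = L^{−2}·α L^{−2p}(L^sL^{−p})^{−2}`. [cite: Balaban1989LargeFieldI, (1.64) p.190] -/
theorem uPlaqP_succ (a L : ℝ) (s p : ℕ) : uPlaqP a L (s + 1) p = L ^ (-2 : ℤ) * uPlaqP a L s p := by
  unfold uPlaqP; rw [pow_succ_mul_zpow]; ring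

/-- `α(L^{s+1}η)^{−3} = L^{−3}·α(L^sη)^{−3}`. [cite: Balaban1989LargeFieldI, (1.64) p.190] -/
theorem uJ_succ (a η L : ℝ) (s : ℕ) : uJ a η L (s + 1) = L ^ (-3 : ℤ) * uJ a η L s := by
  unfold uJ; rw [pow_succ_mul_zpow]; ring

/-- `α(L^{s+1}η)^{−1} = L^{−1}·α(L^sη)^{−1}` — the `|A′|` unit loses exactly ONE power of `L` per scale.
[cite: Balaban1989LargeFieldI, (1.64) p.190] -/
theorem uA_succ (a η L : ℝ) (s : ℕ) : uA a η L (s + 1) = L ^ (-1 : ℤ) * uA a η L s := by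
  unfold uA; rw [pow_succ_mul_zpow]; ring

/-- `α(L^{s+1}η)^{−2} = L^{−2}·α(L^sη)^{−2}`. [cite: Balaban1989LargeFieldI, (1.64) p.190] -/
theorem uDA_succ (a η L : ℝ) (s : ℕ) : uDA a η L (s + 1) = L ^ (-2 : ℤ) * uDA a η L s := by
  unfold uDA; rw [pow_succ_mul_zpow]; ring

/-- `W166 L₀ j j = L₀^0 = 1` (the shell `m = j` of (ii) carries no power of `L₀`). [cite: Balaban1989LargeFieldI, (1.66) p.190] -/
theorem W166_self (L₀ : ℝ) (j : ℕ) : W166 L₀ j j = 1 := by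
  unfold W166; rw [Nat.sub_self, mul_zero, pow_zero]

/-- `α L^{(s+1)−min{p,s+1}}(L^{s+1}L^{−p})^{−3} ≤ L^{−2}·α L^{s−min{p,s}}(L^sL^{−p})^{−3}` (`α ≥ 0`, `L ≥ 1`; the exponent of the first
factor grows by at most one). [cite: Balaban1989LargeFieldI, (1.64) p.190] -/
theorem uJP_succ_le {a L : ℝ} (ha : 0 ≤ a) (hL : 1 ≤ L) (s p : ℕ) : uJP a L (s + 1) p ≤ L ^ (-2 : ℤ) * uJP a L s p := by
  have hL0 : 0 < L := lt_of_lt_of_le one_pos hL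
  have hLne : L ≠ 0 := hL0.ne'
  have hQ : 0 ≤ (L ^ s * L ^ (-(p : ℤ))) ^ (-3 : ℤ) :=
    zpow_nonneg (mul_nonneg (pow_nonneg hL0.le _) (zpow_nonneg hL0.le _)) _
  rcases le_or_gt p s with hps | hps
  · -- `p ≤ s`: both minima are `p`, the exponent grows by exactly one: equality
    have e1 : uJP a L (s + 1) p = L ^ (-2 : ℤ) * uJP a L s p := by
      unfold uJP
      rw [min_eq_left hps, min_eq_left (Nat.le_succ_of_le hps), pow_succ_mul_zpow]
      have ex : ((s + 1 : ℕ) : ℤ) - (p : ℤ) = ((s : ℤ) - (p : ℤ)) + 1 := by push_cast; ring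
      rw [ex, zpow_add_one₀ hLne, show (-3 : ℤ) = -2 + -1 by norm_num, zpow_add₀ hLne, zpow_neg_one]
      field_simp
    rw [e1]
  · -- `s < p`: the minima are `s`, `s+1`, the first factor is `L^0` at both scales
    have e1 : uJP a L (s + 1) p = L ^ (-3 : ℤ) * uJP a L s p := by
      unfold uJP
      rw [min_eq_right hps.le, min_eq_right (Nat.succ_le_of_lt hps), pow_succ_mul_zpow, sub_self, sub_self]
      ring
    rw [e1]
    have hu : 0 ≤ uJP a L s p := by
      unfold uJP; exact mul_nonneg (mul_nonneg ha (zpow_nonneg hL0.le _)) hQ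
    exact mul_le_mul_of_nonneg_right (zpow_le_zpow_right₀ hL (by norm_num)) hu

/-- `L^{n} ≤ 1/L` for `L ≥ 1`, `n ≤ −1`. [folklore] -/
private theorem zpow_le_inv_of_le {L : ℝ} (hL : 1 ≤ L) {n : ℤ} (hn : n ≤ -1) : L ^ n ≤ 1 / L := by
  rw [one_div, ← zpow_neg_one]
  exact zpow_le_zpow_right₀ hL hn

/-- The units are nonnegative for a nonnegative coefficient (`L, η > 0`). [cite: Balaban1989LargeFieldI, (1.64) p.190] -/
theorem units_nonneg {L η a : ℝ} (hL : 0 < L) (hη : 0 < η) (ha : 0 ≤ a) (s p : ℕ) :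
    0 ≤ uPlaq a η L s ∧ 0 ≤ uPlaqP a L s p ∧ 0 ≤ uJ a η L s ∧ 0 ≤ uJP a L s p ∧ 0 ≤ uA a η L s ∧ 0 ≤ uDA a η L s := by
  have h1 : 0 ≤ (L ^ s * η) := by positivity
  have h2 : 0 ≤ L ^ s * L ^ (-(p : ℤ)) := mul_nonneg (pow_nonneg hL.le _) (zpow_nonneg hL.le _)
  unfold uPlaq uPlaqP uJ uJP uA uDA
  exact ⟨mul_nonneg (mul_nonneg ha (sq_nonneg _)) (zpow_nonneg h1 _),
    mul_nonneg (mul_nonneg ha (zpow_nonneg hL.le _)) (zpow_nonneg h2 _), mul_nonneg ha (zpow_nonneg h1 _),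
    mul_nonneg (mul_nonneg ha (zpow_nonneg hL.le _)) (zpow_nonneg h2 _), mul_nonneg ha (zpow_nonneg h1 _),
    mul_nonneg ha (zpow_nonneg h1 _)⟩

/-- The units are linear in their coefficient. [cite: Balaban1989LargeFieldI, (1.64) p.190] -/
theorem units_smul (ρ a η L : ℝ) (s p : ℕ) :
    uPlaq (ρ * a) η L s = ρ * uPlaq a η L s ∧ uPlaqP (ρ * a) L s p = ρ * uPlaqP a L s p ∧ uJ (ρ * a) η L s = ρ * uJ a η L s ∧
      uJP (ρ * a) L s p = ρ * uJP a L s p ∧ uA (ρ * a) η L s = ρ * uA a η L s ∧ uDA (ρ * a) η L s = ρ * uDA a η L s := by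
  unfold uPlaq uPlaqP uJ uJP uA uDA
  exact ⟨by ring, by ring, by ring, by ring, by ring, by ring⟩

/-- **Unit rescaling `s+1 ↦ s`**: with coefficients `α′ ≤ ρα` (`ρ, α ≥ 0`, `L ≥ 1`, `η > 0`) each printed unit at scale `s+1` and
coefficient `α′` is at most `(ρ/L)·` the unit at scale `s` and coefficient `α` — the plaquette / current / derivative units gain
`L^{−2}`, `L^{−3}`, `L^{−2}`, the `|A′|` unit only `L^{−1}` («Notice that we get the stronger restriction on L₀ because of the bounds for
A′»). [cite: Balaban1989LargeFieldI, p.191] -/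
theorem unit_succ_le {L η ρ a a' : ℝ} (hL : 1 ≤ L) (hη : 0 < η) (hρ : 0 ≤ ρ) (ha : 0 ≤ a) (ha' : a' ≤ ρ * a) (s p : ℕ) :
    uPlaq a' η L (s + 1) ≤ ρ / L * uPlaq a η L s ∧ uPlaqP a' L (s + 1) p ≤ ρ / L * uPlaqP a L s p ∧
      uJ a' η L (s + 1) ≤ ρ / L * uJ a η L s ∧ uJP a' L (s + 1) p ≤ ρ / L * uJP a L s p ∧
        uA a' η L (s + 1) ≤ ρ / L * uA a η L s ∧ uDA a' η L (s + 1) ≤ ρ / L * uDA a η L s := by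
  have hL0 : 0 < L := lt_of_lt_of_le one_pos hL
  have hρa : 0 ≤ ρ * a := mul_nonneg hρ ha
  -- the scale-`(s+1)` units are monotone in the coefficient: `E(α′) ≤ E(ρα)`
  have m := units_mono hL0 hη ha' (s + 1) p
  obtain ⟨eP, ePP, eJ, eJP, eA, eDA⟩ := units_smul ρ a η L s p
  obtain ⟨nP, nPP, nJ, nJP, nA, nDA⟩ := units_nonneg hL0 hη ha s p
  have h1 : L ^ (-1 : ℤ) ≤ 1 / L := zpow_le_inv_of_le hL le_rfl
  have h2 : L ^ (-2 : ℤ) ≤ 1 / L := zpow_le_inv_of_le hL (by norm_num)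
  have h3 : L ^ (-3 : ℤ) ≤ 1 / L := zpow_le_inv_of_le hL (by norm_num)
  have conv : ∀ {E' E₁ Ea σ : ℝ}, E' ≤ E₁ → E₁ ≤ σ * (ρ * Ea) → σ ≤ 1 / L → 0 ≤ Ea → E' ≤ ρ / L * Ea := by
    intro E' E₁ Ea σ hE hE₁ hσ hEa
    calc E' ≤ σ * (ρ * Ea) := hE.trans hE₁
      _ ≤ 1 / L * (ρ * Ea) := mul_le_mul_of_nonneg_right hσ (mul_nonneg hρ hEa)
      _ = ρ / L * Ea := by ring
  refine ⟨conv m.1 ?_ h2 nP, conv m.2.1 ?_ h2 nPP, conv m.2.2.1 ?_ h3 nJ, conv m.2.2.2.1 ?_ h2 nJP,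
    conv m.2.2.2.2.1 ?_ h1 nA, conv m.2.2.2.2.2 ?_ h2 nDA⟩
  · rw [uPlaq_succ, eP]
  · rw [uPlaqP_succ, ePP]
  · rw [uJ_succ, eJ]
  · rw [← eJP]; exact uJP_succ_le hρa hL s p
  · rw [uA_succ, eA]
  · rw [uDA_succ, eDA]

end Units

/-! ## §5. The rung-level steps: INTERIOR, CREATION (top rung of (i), shells of (ii)), UPPER, DEEP; restriction and covering -/

section Steps

variable {P : Params} {i : ℕ} {𝔸 : Type*} [NormedRing 𝔸] [NormedAlgebra ℂ 𝔸] [CompleteSpace 𝔸]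
variable {𝓜 : CModel 𝔸}

/-- At the error `α = 0` the (1.48)-relation of `B15.ComplexSpaces` Part C between a quantity and itself holds trivially (`T = id`).
[cite: Balaban1989LargeFieldI, (1.48) p.187] -/
theorem ineq148_self (q β s E : ℝ) : Ineq148 q q 0 β s E := by
  have e : q * (1 + 0 * β * s) + 0 * β * s * E = q := by ring
  unfold Ineq148
  rw [e]

/-- **Restriction**: a rung on regions `R₁`, `Rp₁`, cubes `Cs₁` gives the rung on sub-regions and a sub-family of cubes (same scale,
weights, factor). [cite: Balaban1989LargeFieldI, (1.64)-(1.69) pp.190–191] -/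
theorem rung_of_sub {F : CFrame P i 𝔸} {c : CConsts} {α₀ α₁ : ℕ → ℝ} {R₀ R₁ : Region P i}
    {Rp₀ Rp₁ : (p : ℕ) → Region P (F.bg.lvl p)} {Cs₀ Cs₁ : Set (Region P i)} {s : ℕ} {Wb Wc : ℝ} {U : PBond P i → 𝔸ˣ}
    {A' : PBond P i → 𝔸} {Φ : FieldPair P i 𝔸ˣ 𝔸} (hR : RSub R₀ R₁) (hRp : ∀ p, RSub (Rp₀ p) (Rp₁ p)) (hCs : Cs₀ ⊆ Cs₁)
    (h : Rung 𝓜 F c α₀ α₁ R₁ Rp₁ Cs₁ s Wb Wc U A' Φ) : Rung 𝓜 F c α₀ α₁ R₀ Rp₀ Cs₀ s Wb Wc U A' Φ :=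
  ⟨fun q hq => h.plaqU_lt q (hR.1 hq), fun p hp hpk q hq => h.plaqP_lt p hp hpk q ((hRp p).1 hq),
    fun b hb => h.J_lt b (hR.2.1 hb), fun p hp hpk b hb => h.JP_lt p hp hpk b ((hRp p).2.1 hb),
    fun q hq => h.plaq_lt q (hR.1 hq), fun b hb => h.A_lt b (hR.2.1 hb), fun q hq => h.dA_lt q (hR.2.2 hq),
    fun D hD => h.localGauge D (hCs hD)⟩

/-- **Covering**: two rungs with the same scale, weights and factor on `(R₁, Rp₁, Cs₁)` and `(R₂, Rp₂, Cs₂)` give the rung on any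
`(R₀, Rp₀, Cs₀)` they cover. [cite: Balaban1989LargeFieldI, (1.64) p.190] -/
theorem rung_of_covers {F : CFrame P i 𝔸} {c : CConsts} {α₀ α₁ : ℕ → ℝ} {R₀ R₁ R₂ : Region P i}
    {Rp₀ Rp₁ Rp₂ : (p : ℕ) → Region P (F.bg.lvl p)} {Cs₀ Cs₁ Cs₂ : Set (Region P i)} {s : ℕ} {Wb Wc : ℝ}
    {U : PBond P i → 𝔸ˣ} {A' : PBond P i → 𝔸} {Φ : FieldPair P i 𝔸ˣ 𝔸} (hR : RCovers R₀ R₁ R₂)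
    (hRp : ∀ p, RCovers (Rp₀ p) (Rp₁ p) (Rp₂ p)) (hCs : ∀ D ∈ Cs₀, D ∈ Cs₁ ∨ D ∈ Cs₂)
    (h₁ : Rung 𝓜 F c α₀ α₁ R₁ Rp₁ Cs₁ s Wb Wc U A' Φ) (h₂ : Rung 𝓜 F c α₀ α₁ R₂ Rp₂ Cs₂ s Wb Wc U A' Φ) :
    Rung 𝓜 F c α₀ α₁ R₀ Rp₀ Cs₀ s Wb Wc U A' Φ := by
  refine ⟨fun q hq => ?_, fun p hp hpk q hq => ?_, fun b hb => ?_, fun p hp hpk b hb => ?_, fun q hq => ?_, fun b hb => ?_,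
    fun q hq => ?_, fun D hD => ?_⟩
  · rcases hR.1 hq with h | h
    exacts [h₁.plaqU_lt q h, h₂.plaqU_lt q h]
  · rcases (hRp p).1 hq with h | h
    exacts [h₁.plaqP_lt p hp hpk q h, h₂.plaqP_lt p hp hpk q h]
  · rcases hR.2.1 hb with h | h
    exacts [h₁.J_lt b h, h₂.J_lt b h]
  · rcases (hRp p).2.1 hb with h | h
    exacts [h₁.JP_lt p hp hpk b h, h₂.JP_lt p hp hpk b h]
  · rcases hR.1 hq with h | h
    exacts [h₁.plaq_lt q h, h₂.plaq_lt q h]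
  · rcases hR.2.1 hb with h | h
    exacts [h₁.A_lt b h, h₂.A_lt b h]
  · rcases hR.2.2 hq with h | h
    exacts [h₁.dA_lt q h, h₂.dA_lt q h]
  · rcases hCs D hD with h | h
    exacts [h₁.localGauge D h, h₂.localGauge D h]

variable {S : Shared P i 𝔸} {R R' : Layers S} {c : CConsts} {α₀ α₁ : ℕ → ℝ} {U : PBond P i → 𝔸ˣ} {A' : PBond P i → 𝔸}
  {Φ : FieldPair P i 𝔸ˣ 𝔸}

/-- **INTERIOR** (`m ≤ j`): a rung `m` of (i) at level `n+1` — factor `(1 − βΣ_{i=h+1}^{j+1}2^{−|m−i|} − βΣ_{q=m+1}^{k}2^{−(q−m)})`,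
weight `L₀^{2max{0,m−k₀}}`, units at scale `m` — is the rung `m` of (i) at level `n` on the same regions and cubes: the level-`n`
factor is LARGER by `(β/2)2^{−(j−m)}` (`B15.ComplexSpaces.clause164_interior` at `α = 0`). [cite: Balaban1989LargeFieldI, p.191] -/
theorem rung_interior (hhj : c.h ≤ c.j) {m : ℕ} (hm : m ≤ c.j) (hβ : 0 ≤ c.β) (hL : 0 < c.L) (hη : 0 < c.η)
    (hL₀ : 1 ≤ c.L₀) (hα₀ : 0 ≤ α₀ m) (hα₁ : 0 ≤ α₁ m) {R₁ : Region P i} {Rp₁ : (p : ℕ) → Region P (S.lvl p)}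
    {Cs₁ : Set (Region P i)}
    (h : Rung 𝓜 (frameOf S R') (succC c) α₀ α₁ R₁ Rp₁ Cs₁ m (W164 c.L₀ m c.k₀) (W164 c.L₀ m c.k₀) U A' Φ) :
    Rung 𝓜 (frameOf S R) c α₀ α₁ R₁ Rp₁ Cs₁ m (W164 c.L₀ m c.k₀) (W164 c.L₀ m c.k₀) U A' Φ := by
  have hW : 1 ≤ W164 c.L₀ m c.k₀ := one_le_W164 hL₀ m c.k₀
  have n0 := fun p => units_nonneg hL hη hα₀ m p
  have n1 := fun p => units_nonneg hL hη hα₁ m p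
  have step : ∀ {q E : ℝ}, 0 ≤ E → Clause164 q c.β c.h (c.j + 1) m c.k (W164 c.L₀ m c.k₀) E →
      Clause164 q c.β c.h c.j m c.k (W164 c.L₀ m c.k₀) E := fun hE hq =>
    clause164_interior hhj hm le_rfl (by norm_num) hβ hW hE (ineq148_self _ _ _ _) hq
  exact ⟨fun q hq => step (n0 0).1 (h.plaqU_lt q hq), fun p hp hpk q hq => step (n0 p).2.1 (h.plaqP_lt p hp hpk q hq),
    fun b hb => step (n0 0).2.2.1 (h.J_lt b hb), fun p hp hpk b hb => step (n0 p).2.2.2.1 (h.JP_lt p hp hpk b hb),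
    fun q hq => step (n0 0).1 (h.plaq_lt q hq), fun b hb => step (n1 0).2.2.2.2.1 (h.A_lt b hb),
    fun q hq => step (n1 0).2.2.2.2.2 (h.dA_lt q hq), fun D hD => h.localGauge D hD⟩

/-- **DEEP** (`m ≥ j+2`): a rung `m` of (iii) at level `n+1` is the rung `m` of (iii) at level `n` on the same regions and cubes
(factor larger by `β2^{−(m−j−1)}`, same `c`, same units; `B15.ComplexSpaces.clause168_deep` at `α = 0`). [cite: Balaban1989LargeFieldI, p.191] -/
theorem rung_deep (hhj : c.h ≤ c.j) {m : ℕ} (hm : c.j + 2 ≤ m) (hβ : 0 ≤ c.β) (hL : 0 < c.L) (hη : 0 < c.η)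
    (hα₀ : 0 ≤ α₀ m) (hα₁ : 0 ≤ α₁ m) {R₁ : Region P i} {Rp₁ : (p : ℕ) → Region P (S.lvl p)} {Cs₁ : Set (Region P i)}
    (h : Rung 𝓜 (frameOf S R') (succC c) α₀ α₁ R₁ Rp₁ Cs₁ m (cConst m c.k) 1 U A' Φ) :
    Rung 𝓜 (frameOf S R) c α₀ α₁ R₁ Rp₁ Cs₁ m (cConst m c.k) 1 U A' Φ := by
  have n0 := fun p => units_nonneg hL hη hα₀ m p
  have n1 := fun p => units_nonneg hL hη hα₁ m p
  have step : ∀ {q E : ℝ}, 0 ≤ E → Clause164 q c.β c.h (c.j + 1) m c.k (cConst m c.k) E →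
      Clause164 q c.β c.h c.j m c.k (cConst m c.k) E := fun {q E} hE hq =>
    clause168_deep (q := q) (q' := q) (s := 0) hhj hm le_rfl hβ le_rfl (by rw [zero_mul]; positivity) (one_le_cConst m c.k) hE
      (ineq148_self _ _ _ _) hq
  exact ⟨fun q hq => step (n0 0).1 (h.plaqU_lt q hq), fun p hp hpk q hq => step (n0 p).2.1 (h.plaqP_lt p hp hpk q hq),
    fun b hb => step (n0 0).2.2.1 (h.J_lt b hb), fun p hp hpk b hb => step (n0 p).2.2.2.1 (h.JP_lt p hp hpk b hb),
    fun q hq => step (n0 0).1 (h.plaq_lt q hq), fun b hb => step (n1 0).2.2.2.2.1 (h.A_lt b hb),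
    fun q hq => step (n1 0).2.2.2.2.2 (h.dA_lt q hq), fun D hD => h.localGauge D hD⟩

/-- **UPPER** (`m = j+1`): a rung at scale `j+1` of level `n+1` with the DIAGONAL factor `(1 − βΣ_{i=h+1}^{j+1}2^{−|j+1−i|} −
βΣ_{q=j+2}^{k}2^{−(q−j−1)})` and weights `1` — the shell `j+1` of (ii) (`L₀^{2(j+1−j−1)} = 1`) or, for `j+1 ≤ k₀`, the rung `j+1` of
(i) («no powers of L₀») — is the rung `j+1` of (iii) at level `n` (factor larger by `β`, times `c ≥ 1`; cubes unweighted at both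
levels; `B15.ComplexSpaces.clause168_upper` at `α = 0`). [cite: Balaban1989LargeFieldI, p.191] -/
theorem rung_upper (hhj : c.h ≤ c.j) (hβ : 0 ≤ c.β) (hL : 0 < c.L) (hη : 0 < c.η) (hα₀ : 0 ≤ α₀ (c.j + 1))
    (hα₁ : 0 ≤ α₁ (c.j + 1)) {R₁ : Region P i} {Rp₁ : (p : ℕ) → Region P (S.lvl p)} {Cs₁ : Set (Region P i)} {Wb Wc : ℝ}
    (hWb : Wb = 1) (hWc : Wc = 1) (h : Rung 𝓜 (frameOf S R') (succC c) α₀ α₁ R₁ Rp₁ Cs₁ (c.j + 1) Wb Wc U A' Φ) :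
    Rung 𝓜 (frameOf S R) c α₀ α₁ R₁ Rp₁ Cs₁ (c.j + 1) (cConst (c.j + 1) c.k) 1 U A' Φ := by
  subst hWb hWc
  have n0 := fun p => units_nonneg hL hη hα₀ (c.j + 1) p
  have n1 := fun p => units_nonneg hL hη hα₁ (c.j + 1) p
  have step : ∀ {q E : ℝ}, 0 ≤ q → 0 ≤ E → Clause164 q c.β c.h (c.j + 1) (c.j + 1) c.k 1 E →
      Clause164 q c.β c.h c.j (c.j + 1) c.k (cConst (c.j + 1) c.k) E := by
    intro q E hq hE hcl
    have hn1 : Clause166 q c.β c.h (c.j + 1) (c.j + 1) c.k c.L₀ E := by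
      unfold Clause166; rw [W166_self]; exact hcl
    exact clause168_upper (s := 0) hhj hq le_rfl (by norm_num) hβ le_rfl zero_le_one (one_le_cConst _ _) hE
      (ineq148_self _ _ _ _) hn1
  exact ⟨fun q hq => step (norm_nonneg _) (n0 0).1 (h.plaqU_lt q hq),
    fun p hp hpk q hq => step (norm_nonneg _) (n0 p).2.1 (h.plaqP_lt p hp hpk q hq),
    fun b hb => step (norm_nonneg _) (n0 0).2.2.1 (h.J_lt b hb),
    fun p hp hpk b hb => step (norm_nonneg _) (n0 p).2.2.2.1 (h.JP_lt p hp hpk b hb),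
    fun q hq => step (norm_nonneg _) (n0 0).1 (h.plaq_lt q hq), fun b hb => step (norm_nonneg _) (n1 0).2.2.2.2.1 (h.A_lt b hb),
    fun q hq => step (norm_nonneg _) (n1 0).2.2.2.2.2 (h.dA_lt q hq), fun D hD => h.localGauge D hD⟩

/-- The cube clause under `scale s+1 ↦ s` (`B15.ComplexSpaces.cube165_rescale`): on a cube `D ⊆ D′`, a `G`-valued gauge `u` with
`U^u = exp iηA` on `D′`, `L^{s+1}η|A|, (L^{s+1}η)²|∇^ηA| < W′·BCMα₀′` gives `L^sη|A|, (L^sη)²|∇^ηA| < W·BCMα₀` on `D` as soon as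
`W′ ≤ L₀²W`, `α₀′ ≤ ρα₀`, `L₀²ρ ≤ L` (the SAME `u`, `A`). [cite: Balaban1989LargeFieldI, (1.67) p.190] -/
theorem localGauge_rescale (hL : 1 ≤ c.L) (hBCM : 0 ≤ c.B * c.C * c.M) {s : ℕ} {W W' a a' ρ : ℝ} (hW : 0 ≤ W)
    (hW' : W' ≤ c.L₀ ^ 2 * W) (ha : 0 ≤ a) (ha'0 : 0 ≤ a') (ha' : a' ≤ ρ * a) (hscale : c.L₀ ^ 2 * ρ ≤ c.L) {D D' : Region P i}
    (hDD : RSub D D')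
    (h : ∃ u : Site P i → 𝔸ˣ, (∀ x, u x ∈ 𝓜.G) ∧ ∃ A : PBond P i → 𝔸,
      (∀ b ∈ D'.bonds, gaugeU u U b = expI c.η (A b)) ∧ (∀ b ∈ D'.bonds, A b ∈ 𝓜.g) ∧
        (∀ b ∈ D'.bonds, c.L ^ (s + 1) * c.η * ‖A b‖ < W' * (c.B * c.C * c.M * a')) ∧
          ∀ q ∈ D'.dpairs, (c.L ^ (s + 1) * c.η) ^ 2 * ‖grad c.η q.2.1 (fun y => A ⟨y, q.2.2⟩) q.1‖ < W' * (c.B * c.C * c.M * a')) :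
    ∃ u : Site P i → 𝔸ˣ, (∀ x, u x ∈ 𝓜.G) ∧ ∃ A : PBond P i → 𝔸,
      (∀ b ∈ D.bonds, gaugeU u U b = expI c.η (A b)) ∧ (∀ b ∈ D.bonds, A b ∈ 𝓜.g) ∧
        (∀ b ∈ D.bonds, c.L ^ s * c.η * ‖A b‖ < W * (c.B * c.C * c.M * a)) ∧
          ∀ q ∈ D.dpairs, (c.L ^ s * c.η) ^ 2 * ‖grad c.η q.2.1 (fun y => A ⟨y, q.2.2⟩) q.1‖ < W * (c.B * c.C * c.M * a) := by
  obtain ⟨u, hu, A, hg, hAg, hb, hd⟩ := h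
  have hL0 : 0 < c.L := lt_of_lt_of_le one_pos hL
  refine ⟨u, hu, A, fun b hb' => hg b (hDD.2.1 hb'), fun b hb' => hAg b (hDD.2.1 hb'), fun b hb' => ?_, fun q hq => ?_⟩
  · have h1 := hb b (hDD.2.1 hb')
    set x : ℝ := c.L ^ s * c.η * ‖A b‖ with hx
    have e1 : c.L ^ (s + 1) * c.η * ‖A b‖ = c.L * x := by rw [hx, pow_succ]; ring
    have e2 : c.L ^ 2 * (x / c.L) = c.L * x := by field_simp
    rw [e1] at h1
    have hn1 : Cube165 (c.L * x) (c.L ^ 2 * (x / c.L)) W' c.B c.C c.M a' := ⟨h1, by rw [e2]; exact h1⟩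
    exact (cube165_rescale hL hW hW' hBCM ha ha'0 ha' hscale hn1).1
  · have h1 := hd q (hDD.2.2 hq)
    set x : ℝ := (c.L ^ s * c.η) ^ 2 * ‖grad c.η q.2.1 (fun y => A ⟨y, q.2.2⟩) q.1‖ with hx
    have e1 : (c.L ^ (s + 1) * c.η) ^ 2 * ‖grad c.η q.2.1 (fun y => A ⟨y, q.2.2⟩) q.1‖ = c.L ^ 2 * x := by
      rw [hx, pow_succ]; ring
    have e2 : c.L * (c.L * x) = c.L ^ 2 * x := by ring
    rw [e1] at h1
    have hn1 : Cube165 (c.L * (c.L * x)) (c.L ^ 2 * x) W' c.B c.C c.M a' := ⟨by rw [e2]; exact h1, h1⟩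
    exact (cube165_rescale hL hW hW' hBCM ha ha'0 ha' hscale hn1).2

/-- From the located creation data `L₀²ρ/L ≤ κ ≤ 1`: the cube scale condition `L₀²ρ ≤ L` (`L > 0`). [folklore] -/
private theorem scale_of_kappa {L L₀ ρ κ : ℝ} (hL : 0 < L) (hκ : L₀ ^ 2 * (ρ / L) ≤ κ) (hκ1 : κ ≤ 1) : L₀ ^ 2 * ρ ≤ L := by
  have h : L₀ ^ 2 * ρ / L ≤ 1 := by rw [mul_div_assoc]; exact hκ.trans hκ1
  rwa [div_le_one hL] at h

/-- **CREATION, top rung of (i)**: the rung `j+1` of (i) at level `n+1` — diagonal factor, weight `L₀^{2max{0,j+1−k₀}} ≤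
L₀²·L₀^{2max{0,j−k₀}}`, units at scale `j+1` with `α_{·,j+1} ≤ ρα_{·,j}`, on `(Ω″_{j+1}∖Ω_{k₀+1})∩X` and its cubes — gives the rung `j`
of (i) at level `n` on any sub-regions and on cubes contained in its cubes, PROVIDED `L₀²ρ/L ≤ κ ≤ 1` and `β/2 ≤ (1−κ)(1−2β)` (the
creation condition of `B15.ComplexSpaces` at `α = 0`; `clause164_creation_top`, `cube165_rescale`). [cite: Balaban1989LargeFieldI, p.191] -/
theorem rung_creation_top (hhj : c.h ≤ c.j) (hjk : c.j + 1 ≤ c.k) (hβ : 0 ≤ c.β) (hβ4 : c.β ≤ 1 / 4) (hL : 1 ≤ c.L)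
    (hη : 0 < c.η) (hL₀ : 1 ≤ c.L₀) (hBCM : 0 ≤ c.B * c.C * c.M) {ρ κ : ℝ} (hρ : 0 ≤ ρ) (hκ : c.L₀ ^ 2 * (ρ / c.L) ≤ κ)
    (hκ1 : κ ≤ 1) (c2 : c.β * (1 / 2) ≤ (1 - κ) * (1 - 2 * c.β)) (h0j : 0 ≤ α₀ c.j) (h0j1 : 0 ≤ α₀ (c.j + 1))
    (h0g : α₀ (c.j + 1) ≤ ρ * α₀ c.j) (h1j : 0 ≤ α₁ c.j) (h1j1 : 0 ≤ α₁ (c.j + 1)) (h1g : α₁ (c.j + 1) ≤ ρ * α₁ c.j)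
    {R₀ R₁ : Region P i} {Rp₀ Rp₁ : (p : ℕ) → Region P (S.lvl p)} {Cs₀ Cs₁ : Set (Region P i)} (hR : RSub R₀ R₁)
    (hRp : ∀ p, RSub (Rp₀ p) (Rp₁ p)) (hCs : ∀ D ∈ Cs₀, ∃ D' ∈ Cs₁, RSub D D')
    (h : Rung 𝓜 (frameOf S R') (succC c) α₀ α₁ R₁ Rp₁ Cs₁ (c.j + 1) (W164 c.L₀ (c.j + 1) c.k₀) (W164 c.L₀ (c.j + 1) c.k₀)
      U A' Φ) :
    Rung 𝓜 (frameOf S R) c α₀ α₁ R₀ Rp₀ Cs₀ c.j (W164 c.L₀ c.j c.k₀) (W164 c.L₀ c.j c.k₀) U A' Φ := by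
  have hL0 : 0 < c.L := lt_of_lt_of_le one_pos hL
  have u0 := fun p => unit_succ_le hL hη hρ h0j h0g c.j p
  have u1 := fun p => unit_succ_le hL hη hρ h1j h1g c.j p
  have n0 := fun p => units_nonneg hL0 hη h0j c.j p
  have n1 := fun p => units_nonneg hL0 hη h1j c.j p
  have n0' := fun p => units_nonneg hL0 hη h0j1 (c.j + 1) p
  have n1' := fun p => units_nonneg hL0 hη h1j1 (c.j + 1) p
  have hκ' : c.L₀ ^ 2 * (ρ / c.L) * (1 + 0 * c.β) ≤ κ := by rw [zero_mul, add_zero, mul_one]; exact hκ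
  have c1 : 0 * c.β ≤ (1 - κ) * (1 - 3 * c.β) := by rw [zero_mul]; exact mul_nonneg (by linarith) (by linarith)
  have c2' : c.β * (0 + 1 / 2) ≤ (1 - κ) * (1 - 2 * c.β) := by rw [zero_add]; exact c2
  have step : ∀ {q E E' : ℝ}, 0 ≤ q → 0 ≤ E → 0 ≤ E' → E' ≤ ρ / c.L * E →
      Clause164 q c.β c.h (c.j + 1) (c.j + 1) c.k (W164 c.L₀ (c.j + 1) c.k₀) E' →
        Clause164 q c.β c.h c.j c.j c.k (W164 c.L₀ c.j c.k₀) E := fun hq hE hE'0 hE' hcl =>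
    clause164_creation_top hhj hjk hq le_rfl hβ hL₀ hE hE'0 hE' hκ' hκ1 c1 c2' (ineq148_self _ _ _ _) hcl
  refine ⟨fun q hq => step (norm_nonneg _) (n0 0).1 (n0' 0).1 (u0 0).1 (h.plaqU_lt q (hR.1 hq)),
    fun p hp hpk q hq => step (norm_nonneg _) (n0 p).2.1 (n0' p).2.1 (u0 p).2.1 (h.plaqP_lt p hp hpk q ((hRp p).1 hq)),
    fun b hb => step (norm_nonneg _) (n0 0).2.2.1 (n0' 0).2.2.1 (u0 0).2.2.1 (h.J_lt b (hR.2.1 hb)),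
    fun p hp hpk b hb => step (norm_nonneg _) (n0 p).2.2.2.1 (n0' p).2.2.2.1 (u0 p).2.2.2.1 (h.JP_lt p hp hpk b ((hRp p).2.1 hb)),
    fun q hq => step (norm_nonneg _) (n0 0).1 (n0' 0).1 (u0 0).1 (h.plaq_lt q (hR.1 hq)),
    fun b hb => step (norm_nonneg _) (n1 0).2.2.2.2.1 (n1' 0).2.2.2.2.1 (u1 0).2.2.2.2.1 (h.A_lt b (hR.2.1 hb)),
    fun q hq => step (norm_nonneg _) (n1 0).2.2.2.2.2 (n1' 0).2.2.2.2.2 (u1 0).2.2.2.2.2 (h.dA_lt q (hR.2.2 hq)),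
    fun D hD => ?_⟩
  obtain ⟨D', hD', hDD'⟩ := hCs D hD
  exact localGauge_rescale hL hBCM (W164_nonneg c.L₀ c.j c.k₀) (W164_succ_le hL₀ c.j c.k₀) h0j h0j1 h0g
    (scale_of_kappa hL0 hκ hκ1) hDD' (h.localGauge D' hD')

/-- **CREATION, shells of (ii)** (`k₀+1 ≤ m ≤ j`): the shell `m` of (ii) at level `n+1` — diagonal factor, weight `L₀^{2(j+1−m)} =
L₀²·L₀^{2(j−m)}`, units at scale `j+1` — gives the shell `m` of (ii) at level `n` (units at scale `j`) on any sub-regions and on cubes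
contained in its cubes («of the size CML^jη» inside «of the size CML^{j+1}η»), under the same creation condition
(`clause166_creation`, `cube165_rescale`). [cite: Balaban1989LargeFieldI, p.191] -/
theorem rung_creationII (hhj : c.h ≤ c.j) (hjk : c.j + 1 ≤ c.k) {m : ℕ} (hm : m ≤ c.j) (hβ : 0 ≤ c.β) (hβ4 : c.β ≤ 1 / 4)
    (hL : 1 ≤ c.L) (hη : 0 < c.η) (hL₀ : 1 ≤ c.L₀) (hBCM : 0 ≤ c.B * c.C * c.M) {ρ κ : ℝ} (hρ : 0 ≤ ρ)
    (hκ : c.L₀ ^ 2 * (ρ / c.L) ≤ κ) (hκ1 : κ ≤ 1) (c2 : c.β * (1 / 2) ≤ (1 - κ) * (1 - 2 * c.β)) (h0j : 0 ≤ α₀ c.j)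
    (h0j1 : 0 ≤ α₀ (c.j + 1)) (h0g : α₀ (c.j + 1) ≤ ρ * α₀ c.j) (h1j : 0 ≤ α₁ c.j) (h1j1 : 0 ≤ α₁ (c.j + 1))
    (h1g : α₁ (c.j + 1) ≤ ρ * α₁ c.j) {R₀ R₁ : Region P i} {Rp₀ Rp₁ : (p : ℕ) → Region P (S.lvl p)}
    {Cs₀ Cs₁ : Set (Region P i)} (hR : RSub R₀ R₁) (hRp : ∀ p, RSub (Rp₀ p) (Rp₁ p))
    (hCs : ∀ D ∈ Cs₀, ∃ D' ∈ Cs₁, RSub D D')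
    (h : Rung 𝓜 (frameOf S R') (succC c) α₀ α₁ R₁ Rp₁ Cs₁ (c.j + 1) (W166 c.L₀ (c.j + 1) m) (W166 c.L₀ (c.j + 1) m) U A' Φ) :
    Rung 𝓜 (frameOf S R) c α₀ α₁ R₀ Rp₀ Cs₀ c.j (W166 c.L₀ c.j m) (W166 c.L₀ c.j m) U A' Φ := by
  have hL0 : 0 < c.L := lt_of_lt_of_le one_pos hL
  have u0 := fun p => unit_succ_le hL hη hρ h0j h0g c.j p
  have u1 := fun p => unit_succ_le hL hη hρ h1j h1g c.j p
  have n0 := fun p => units_nonneg hL0 hη h0j c.j p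
  have n1 := fun p => units_nonneg hL0 hη h1j c.j p
  have n0' := fun p => units_nonneg hL0 hη h0j1 (c.j + 1) p
  have n1' := fun p => units_nonneg hL0 hη h1j1 (c.j + 1) p
  have hκ' : c.L₀ ^ 2 * (ρ / c.L) * (1 + 0 * c.β) ≤ κ := by rw [zero_mul, add_zero, mul_one]; exact hκ
  have c1 : 0 * c.β ≤ (1 - κ) * (1 - 3 * c.β) := by rw [zero_mul]; exact mul_nonneg (by linarith) (by linarith)
  have c2' : c.β * (0 + 1 / 2) ≤ (1 - κ) * (1 - 2 * c.β) := by rw [zero_add]; exact c2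
  have step : ∀ {q E E' : ℝ}, 0 ≤ q → 0 ≤ E → 0 ≤ E' → E' ≤ ρ / c.L * E →
      Clause164 q c.β c.h (c.j + 1) (c.j + 1) c.k (W166 c.L₀ (c.j + 1) m) E' →
        Clause164 q c.β c.h c.j c.j c.k (W166 c.L₀ c.j m) E := fun {q E E'} hq hE hE'0 hE' hcl =>
    clause166_creation (q := q) (q' := q) hhj hjk hm hq le_rfl hβ hL₀ hE hE'0 hE' hκ' hκ1 c1 c2' (ineq148_self _ _ _ _) hcl
  refine ⟨fun q hq => step (norm_nonneg _) (n0 0).1 (n0' 0).1 (u0 0).1 (h.plaqU_lt q (hR.1 hq)),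
    fun p hp hpk q hq => step (norm_nonneg _) (n0 p).2.1 (n0' p).2.1 (u0 p).2.1 (h.plaqP_lt p hp hpk q ((hRp p).1 hq)),
    fun b hb => step (norm_nonneg _) (n0 0).2.2.1 (n0' 0).2.2.1 (u0 0).2.2.1 (h.J_lt b (hR.2.1 hb)),
    fun p hp hpk b hb => step (norm_nonneg _) (n0 p).2.2.2.1 (n0' p).2.2.2.1 (u0 p).2.2.2.1 (h.JP_lt p hp hpk b ((hRp p).2.1 hb)),
    fun q hq => step (norm_nonneg _) (n0 0).1 (n0' 0).1 (u0 0).1 (h.plaq_lt q (hR.1 hq)),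
    fun b hb => step (norm_nonneg _) (n1 0).2.2.2.2.1 (n1' 0).2.2.2.2.1 (u1 0).2.2.2.2.1 (h.A_lt b (hR.2.1 hb)),
    fun q hq => step (norm_nonneg _) (n1 0).2.2.2.2.2 (n1' 0).2.2.2.2.2 (u1 0).2.2.2.2.2 (h.dA_lt q (hR.2.2 hq)),
    fun D hD => ?_⟩
  obtain ⟨D', hD', hDD'⟩ := hCs D hD
  exact localGauge_rescale hL hBCM (W166_nonneg c.L₀ c.j m) (le_of_eq (W166_succ c.L₀ hm)) h0j h0j1 h0g
    (scale_of_kappa hL0 hκ hκ1) hDD' (h.localGauge D' hD')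

end Steps

/-! ## §6. «They form a descending sequence for increasing n» -/

section Descent

variable {P : Params} {i : ℕ} {𝔸 : Type*} [NormedRing 𝔸] [NormedAlgebra ℂ 𝔸] [CompleteSpace 𝔸]
variable {𝓜 : CModel 𝔸} {S : Shared P i 𝔸} {R R' : Layers S} {c : CConsts} {α₀ α₁ : ℕ → ℝ}

/-- **The descent of the defining condition**: under the located bookkeeping `Nested c R′ R`, `h ≤ j`, `j+1 ≤ k`, `0 ≤ β ≤ 1/4`,
`1 ≤ L`, `1 ≤ L₀`, `η > 0`, `BCM ≥ 0`, nonnegative sequences with `α_{·,j+1} ≤ ρα_{·,j}` (`ρ ≥ 0`) and the creation condition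
`L₀²ρ/L ≤ κ ≤ 1`, `β/2 ≤ (1−κ)(1−2β)`, every pair satisfying the level-`(n+1)` conditions (i)–(iii) satisfies the level-`n` ones —
with the SAME factorisation `𝕌 = (exp iηA′)U`: (i) rungs `m < j` INTERIOR; rung `j` = INTERIOR on `(Ω″_j∖Ω″_{j+1})` ∪ CREATION on
`(Ω″_{j+1}∖Ω_{k₀+1})`; (ii) CREATION shell by shell; (iii) rung `j+1` UPPER, rungs `m ≥ j+2` DEEP. [cite: Balaban1989LargeFieldI, p.191] -/
theorem satisfies164_descent (hN : Nested c R' R) (hhj : c.h ≤ c.j) (hjk : c.j + 1 ≤ c.k) (hβ : 0 ≤ c.β)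
    (hβ4 : c.β ≤ 1 / 4) (hL : 1 ≤ c.L) (hη : 0 < c.η) (hL₀ : 1 ≤ c.L₀) (hBCM : 0 ≤ c.B * c.C * c.M)
    (hα₀ : ∀ m, 0 ≤ α₀ m) (hα₁ : ∀ m, 0 ≤ α₁ m) {ρ κ : ℝ} (hρ : 0 ≤ ρ) (h0g : α₀ (c.j + 1) ≤ ρ * α₀ c.j)
    (h1g : α₁ (c.j + 1) ≤ ρ * α₁ c.j) (hκ : c.L₀ ^ 2 * (ρ / c.L) ≤ κ) (hκ1 : κ ≤ 1)
    (c2 : c.β * (1 / 2) ≤ (1 - κ) * (1 - 2 * c.β)) {Φ : FieldPair P i 𝔸ˣ 𝔸}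
    (h : Satisfies164 𝓜 (frameOf S R') (succC c) α₀ α₁ Φ) : Satisfies164 𝓜 (frameOf S R) c α₀ α₁ Φ := by
  have hL0 : 0 < c.L := lt_of_lt_of_le one_pos hL
  obtain ⟨hJ, U, A', hf, hG, hgc, h1, h2, h3⟩ := h
  refine ⟨hJ, U, A', hf, hG, hgc, fun m hm hmj => ?_, fun m hm hmj => ?_, fun m hm hmk => ?_⟩
  · -- (i): rungs `m < j` interior; rung `j` covered
    rcases hmj.lt_or_eq with hlt | heq
    · exact rung_of_sub (hN.subI m hm hlt) (hN.subIp m hm hlt) (hN.cubesI m hm hlt)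
        (rung_interior hhj hmj hβ hL0 hη hL₀ (hα₀ m) (hα₁ m) (h1 m hm (by simp only [succC_j]; omega)))
    · rw [heq]
      refine rung_of_covers hN.topI hN.topIp (Cs₂ := {D | ∃ D' ∈ R'.cubesI (c.j + 1), RSub D D'}) hN.cubesTopI ?_ ?_
      · exact rung_interior hhj le_rfl hβ hL0 hη hL₀ (hα₀ c.j) (hα₁ c.j) (h1 c.j (by omega) (by simp only [succC_j]; omega))
      · exact rung_creation_top hhj hjk hβ hβ4 hL hη hL₀ hBCM hρ hκ hκ1 c2 (hα₀ _) (hα₀ _) h0g (hα₁ _) (hα₁ _) h1g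
          (rsub_refl _) (fun p => rsub_refl _) (fun D hD => hD) (h1 (c.j + 1) (by omega) (le_of_eq (succC_j c).symm))
  · -- (ii): creation shell by shell
    exact rung_creationII hhj hjk hmj hβ hβ4 hL hη hL₀ hBCM hρ hκ hκ1 c2 (hα₀ _) (hα₀ _) h0g (hα₁ _) (hα₁ _) h1g
      (hN.subII m hm hmj) (hN.subIIp m hm hmj) (hN.cubesII m hm hmj) (h2 m hm (by simp only [succC_j]; omega))
  · -- (iii): rung `j+1` upper, rungs `m ≥ j+2` deep
    rcases (show c.j + 2 ≤ m ∨ m = c.j + 1 by omega) with hdeep | htop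
    · exact rung_of_sub (hN.subIII m hdeep hmk) (hN.subIIIp m hdeep hmk) (hN.cubesIII m hdeep hmk)
        (rung_deep hhj hdeep hβ hL0 hη (hα₀ m) (hα₁ m) (h3 m (by simp only [succC_j]; omega) hmk))
    · rw [htop]
      rcases Nat.lt_or_ge c.j c.k₀ with hlow | hhigh
      · -- `j+1 ≤ k₀`: «the point (ii) is empty»; the source is the rung `j+1` of (i), «no powers of L₀»
        have hW : W164 c.L₀ (c.j + 1) c.k₀ = 1 := W164_of_le c.L₀ (by omega)
        exact rung_of_sub (hN.upI (by omega)) (hN.upIp (by omega)) (hN.cubesUpI (by omega))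
          (rung_upper hhj hβ hL0 hη (hα₀ _) (hα₁ _) hW hW (h1 (c.j + 1) (by omega) (le_of_eq (succC_j c).symm)))
      · -- `k₀+1 ≤ j+1`: the source is the shell `j+1` of (ii)
        have hW : W166 c.L₀ (c.j + 1) (c.j + 1) = 1 := W166_self c.L₀ (c.j + 1)
        exact rung_of_sub (hN.upII (by omega)) (hN.upIIp (by omega)) (hN.cubesUpII (by omega))
          (rung_upper hhj hβ hL0 hη (hα₀ _) (hα₁ _) hW hW (h2 (c.j + 1) (by simp only [succC]; omega) (le_of_eq (succC_j c).symm)))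

variable (𝓜)

/-- **«They form a descending sequence for increasing n»** (p. 191): `Ũ^{(n+1)c}_k(X, α̃₀, α̃₁) ⊆ Ũ^{(n)c}_k(X, α̃₀, α̃₁)` for the
typed sets — `space164 𝓜 (frameOf S R′) (succC c) α̃₀ α̃₁ ⊆ space164 𝓜 (frameOf S R) c α̃₀ α̃₁` — under the located bookkeeping
`Nested c R′ R` of the two levels' printed region / cube families and the hypotheses of `satisfies164_descent` (the located form
`L₀²ρ/L ≤ κ ≤ 1`, `β/2 ≤ (1−κ)(1−2β)` of print's «if β and L₀ satisfy certain conditions»). [cite: Balaban1989LargeFieldI, p.191] -/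
theorem space164_descent (hN : Nested c R' R) (hhj : c.h ≤ c.j) (hjk : c.j + 1 ≤ c.k) (hβ : 0 ≤ c.β) (hβ4 : c.β ≤ 1 / 4)
    (hL : 1 ≤ c.L) (hη : 0 < c.η) (hL₀ : 1 ≤ c.L₀) (hBCM : 0 ≤ c.B * c.C * c.M) (hα₀ : ∀ m, 0 ≤ α₀ m) (hα₁ : ∀ m, 0 ≤ α₁ m)
    {ρ κ : ℝ} (hρ : 0 ≤ ρ) (h0g : α₀ (c.j + 1) ≤ ρ * α₀ c.j) (h1g : α₁ (c.j + 1) ≤ ρ * α₁ c.j)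
    (hκ : c.L₀ ^ 2 * (ρ / c.L) ≤ κ) (hκ1 : κ ≤ 1) (c2 : c.β * (1 / 2) ≤ (1 - κ) * (1 - 2 * c.β)) :
    space164 𝓜 (frameOf S R') (succC c) α₀ α₁ ⊆ space164 𝓜 (frameOf S R) c α₀ α₁ :=
  fun _ h => satisfies164_descent hN hhj hjk hβ hβ4 hL hη hL₀ hBCM hα₀ hα₁ hρ h0g h1g hκ hκ1 c2 h

/-- **The printed sufficient condition**: «for example if β ≦ 1/4 and L₀² ≦ (1/3)L» — with `1 ≤ L₀` and a growth ratio `ρ ≤ 9/4` of the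
sequences at `j` (`α_{·,j+1} ≤ ρα_{·,j}`) the located creation data hold with `κ = 3/4` (`L₀²ρ/L ≤ ρ/3 ≤ 3/4`, and `β/2 ≤ ¼(1−2β)` iff
`β ≤ 1/4`), so the spaces descend.  (`9/4` is arithmetic of this reading, not printed; `B15.ComplexSpaces` Part E bounds the growth by
`2` under [III] (2.28).) [cite: Balaban1989LargeFieldI, p.191] -/
theorem space164_descent_printed (hN : Nested c R' R) (hhj : c.h ≤ c.j) (hjk : c.j + 1 ≤ c.k) (hβ : 0 ≤ c.β)
    (hβ4 : c.β ≤ 1 / 4) (hL₀ : 1 ≤ c.L₀) (hthird : c.L₀ ^ 2 ≤ c.L / 3) (hη : 0 < c.η) (hBCM : 0 ≤ c.B * c.C * c.M)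
    (hα₀ : ∀ m, 0 ≤ α₀ m) (hα₁ : ∀ m, 0 ≤ α₁ m) {ρ : ℝ} (hρ : 0 ≤ ρ) (hρ94 : ρ ≤ 9 / 4)
    (h0g : α₀ (c.j + 1) ≤ ρ * α₀ c.j) (h1g : α₁ (c.j + 1) ≤ ρ * α₁ c.j) :
    space164 𝓜 (frameOf S R') (succC c) α₀ α₁ ⊆ space164 𝓜 (frameOf S R) c α₀ α₁ := by
  have hL₀2 : 1 ≤ c.L₀ ^ 2 := one_le_pow₀ hL₀
  have hL : 1 ≤ c.L := by linarith
  have hL0 : 0 < c.L := lt_of_lt_of_le one_pos hL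
  have hκ : c.L₀ ^ 2 * (ρ / c.L) ≤ 3 / 4 := by
    have h1 : c.L₀ ^ 2 * (ρ / c.L) ≤ c.L / 3 * (ρ / c.L) := mul_le_mul_of_nonneg_right hthird (div_nonneg hρ hL0.le)
    have h2 : c.L / 3 * (ρ / c.L) = ρ / 3 := by field_simp
    linarith
  have c2 : c.β * (1 / 2) ≤ (1 - 3 / 4) * (1 - 2 * c.β) := by linarith
  exact space164_descent 𝓜 hN hhj hjk hβ hβ4 hL hη hL₀ hBCM hα₀ hα₁ hρ h0g h1g hκ (by norm_num) c2

/-- The same in the claim shape of `B15.ComplexSpaces`: `Descends S₁ S₀ id` with `S₁` = membership in the level-`(n+1)` space and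
`S₀` = membership in the level-`n` space («They form a descending sequence»; `T = id`). [cite: Balaban1989LargeFieldI, p.191] -/
theorem descends_id (hN : Nested c R' R) (hhj : c.h ≤ c.j) (hjk : c.j + 1 ≤ c.k) (hβ : 0 ≤ c.β) (hβ4 : c.β ≤ 1 / 4)
    (hL₀ : 1 ≤ c.L₀) (hthird : c.L₀ ^ 2 ≤ c.L / 3) (hη : 0 < c.η) (hBCM : 0 ≤ c.B * c.C * c.M) (hα₀ : ∀ m, 0 ≤ α₀ m)
    (hα₁ : ∀ m, 0 ≤ α₁ m) {ρ : ℝ} (hρ : 0 ≤ ρ) (hρ94 : ρ ≤ 9 / 4) (h0g : α₀ (c.j + 1) ≤ ρ * α₀ c.j)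
    (h1g : α₁ (c.j + 1) ≤ ρ * α₁ c.j) :
    Descends (fun Φ : FieldPair P i 𝔸ˣ 𝔸 => Φ ∈ space164 𝓜 (frameOf S R') (succC c) α₀ α₁)
      (fun Φ => Φ ∈ space164 𝓜 (frameOf S R) c α₀ α₁) id :=
  fun _ h => space164_descent_printed 𝓜 hN hhj hjk hβ hβ4 hL₀ hthird hη hBCM hα₀ hα₁ hρ hρ94 h0g h1g h

end Descent

/-! ## §7. «a descending SEQUENCE»: the constants of level `n` and the chain of inclusions -/

section Chain

/-- The constants of level `n` above a base level: `j ↦ j + n`, everything else unchanged (`levelC c 0 = c`,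
`levelC c (n+1) = succC (levelC c n)`). [cite: Balaban1989LargeFieldI, p.191] -/
def levelC (c : CConsts) (n : ℕ) : CConsts where
  k := c.k
  h := c.h
  j := c.j + n
  k₀ := c.k₀
  η := c.η
  L := c.L
  L₀ := c.L₀
  β := c.β
  B := c.B
  C := c.C
  M := c.M

/-- `levelC c 0 = c`. [cite: Balaban1989LargeFieldI, p.191] -/
theorem levelC_zero (c : CConsts) : levelC c 0 = c := rfl

/-- `levelC c (n+1) = succC (levelC c n)`. [cite: Balaban1989LargeFieldI, p.191] -/
theorem levelC_succ (c : CConsts) (n : ℕ) : levelC c (n + 1) = succC (levelC c n) := rfl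

/-- `(levelC c n).j = j + n`. [cite: Balaban1989LargeFieldI, p.191] -/
@[simp] theorem levelC_j (c : CConsts) (n : ℕ) : (levelC c n).j = c.j + n := rfl

variable {P : Params} {i : ℕ} {𝔸 : Type*} [NormedRing 𝔸] [NormedAlgebra ℂ 𝔸] [CompleteSpace 𝔸]
variable (𝓜 : CModel 𝔸) {S : Shared P i 𝔸} {α₀ α₁ : ℕ → ℝ}

/-- **The descending sequence** `Ũ^{(n+d)c}_k ⊆ ⋯ ⊆ Ũ^{(n+1)c}_k ⊆ Ũ^{(n)c}_k`: for a sequence of level frames `Rs n` over the same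
shared data with `Nested (levelC c n) (Rs (n+1)) (Rs n)` at every level, nonnegative sequences with growth ratio `α_{·,m+1} ≤ ρα_{·,m}`,
and the hypotheses of `space164_descent` (which do not depend on the level), the spaces decrease along `n` as long as `j + 1 ≤ k`
(`B15.ComplexSpaces.descends_comp` iterated). [cite: Balaban1989LargeFieldI, p.191] -/
theorem space164_descent_chain {Rs : ℕ → Layers S} {c : CConsts} (hN : ∀ n, Nested (levelC c n) (Rs (n + 1)) (Rs n))
    (hhj : c.h ≤ c.j) (hβ : 0 ≤ c.β) (hβ4 : c.β ≤ 1 / 4) (hL : 1 ≤ c.L) (hη : 0 < c.η) (hL₀ : 1 ≤ c.L₀)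
    (hBCM : 0 ≤ c.B * c.C * c.M) (hα₀ : ∀ m, 0 ≤ α₀ m) (hα₁ : ∀ m, 0 ≤ α₁ m) {ρ κ : ℝ} (hρ : 0 ≤ ρ)
    (h0g : ∀ m, α₀ (m + 1) ≤ ρ * α₀ m) (h1g : ∀ m, α₁ (m + 1) ≤ ρ * α₁ m) (hκ : c.L₀ ^ 2 * (ρ / c.L) ≤ κ) (hκ1 : κ ≤ 1)
    (c2 : c.β * (1 / 2) ≤ (1 - κ) * (1 - 2 * c.β)) (n d : ℕ) (hk : c.j + n + d ≤ c.k) :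
    space164 𝓜 (frameOf S (Rs (n + d))) (levelC c (n + d)) α₀ α₁ ⊆ space164 𝓜 (frameOf S (Rs n)) (levelC c n) α₀ α₁ := by
  induction d with
  | zero => exact fun _ h => h
  | succ d ih =>
    have step : space164 𝓜 (frameOf S (Rs (n + d + 1))) (succC (levelC c (n + d))) α₀ α₁ ⊆
        space164 𝓜 (frameOf S (Rs (n + d))) (levelC c (n + d)) α₀ α₁ :=
      space164_descent 𝓜 (hN (n + d)) (show c.h ≤ c.j + (n + d) by omega) (show c.j + (n + d) + 1 ≤ c.k by omega) hβ hβ4 hL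
        hη hL₀ hBCM hα₀ hα₁ hρ (h0g _) (h1g _) hκ hκ1 c2
    exact step.trans (ih (by omega))

end Chain

/-! ## §8. Consistency of the bookkeeping: the largest level-`n` families allowed below given level-`(n+1)` families -/

section Lower

variable {P : Params} {i : ℕ} {𝔸 : Type*}

/-- The union of two regions-as-index-sets (how «(Ω″_j∖Ω″_{j+1}) ∪ (Ω″_{j+1}∖Ω_{k₀+1})» is read on the index sets).
[cite: Balaban1989LargeFieldI, (1.64) p.190] -/
def runion (R₁ R₂ : Region P i) : Region P i where
  plaqs := R₁.plaqs ∪ R₂.plaqs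
  bonds := R₁.bonds ∪ R₂.bonds
  dpairs := R₁.dpairs ∪ R₂.dpairs

/-- The union is covered by its two parts (API of the index-set reading). [cite: Balaban1989LargeFieldI, (1.64) p.190] -/
theorem rcovers_runion (R₁ R₂ : Region P i) : RCovers (runion R₁ R₂) R₁ R₂ :=
  ⟨subset_rfl, subset_rfl, subset_rfl⟩

variable [Monoid 𝔸] {S : Shared P i 𝔸}

/-- Given the level-`(n+1)` families `R′`, the LARGEST level-`n` families the bookkeeping `Nested c R′ ·` allows («(ours)», a
consistency witness — print's own level-`n` families satisfy `Nested` and are contained in these): (i) rungs `m < j` unchanged, rung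
`j` = the union of the rungs `j`, `j+1` of `R′` with the rung-`j` cubes of `R′` and all sub-regions of its rung-`(j+1)` cubes; (ii) the
shells of `R′` with all sub-regions of their cubes; (iii) rungs `m ≥ j+2` unchanged, rung `j+1` = the rung `j+1` of (i) of `R′` if
`j+1 ≤ k₀`, else its shell `j+1` of (ii). [cite: Balaban1989LargeFieldI, p.191] -/
def lower (c : CConsts) (R' : Layers S) : Layers S where
  layerI m := if m < c.j then R'.layerI m else runion (R'.layerI c.j) (R'.layerI (c.j + 1))
  cubesI m := if m < c.j then R'.cubesI m else R'.cubesI c.j ∪ {D | ∃ D' ∈ R'.cubesI (c.j + 1), RSub D D'}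
  layerII := R'.layerII
  cubesII m := {D | ∃ D' ∈ R'.cubesII m, RSub D D'}
  layerIII m := if c.j + 2 ≤ m then R'.layerIII m else if c.j + 1 ≤ c.k₀ then R'.layerI (c.j + 1) else R'.layerII (c.j + 1)
  cubesIII m := if c.j + 2 ≤ m then R'.cubesIII m else if c.j + 1 ≤ c.k₀ then R'.cubesI (c.j + 1) else R'.cubesII (c.j + 1)
  player p m := if m < c.j then R'.player p m else runion (R'.player p c.j) (R'.player p (c.j + 1))
  playerII := R'.playerII
  playerIII p m :=
    if c.j + 2 ≤ m then R'.playerIII p m else if c.j + 1 ≤ c.k₀ then R'.player p (c.j + 1) else R'.playerII p (c.j + 1)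

/-- **The bookkeeping is consistent**: `Nested c R′ (lower c R′)` for every level-`(n+1)` family `R′` (so `space164_descent` applies
with `R := lower c R′`). [cite: Balaban1989LargeFieldI, p.191] -/
theorem nested_lower (c : CConsts) (R' : Layers S) : Nested c R' (lower c R') where
  subI m _ hm := by simp only [lower, if_pos hm]; exact rsub_refl _
  subIp m _ hm p := by simp only [lower, if_pos hm]; exact rsub_refl _
  cubesI m _ hm := by simp only [lower, if_pos hm]; exact subset_rfl
  topI := by simp only [lower, lt_irrefl, if_false]; exact rcovers_runion _ _
  topIp p := by simp only [lower, lt_irrefl, if_false]; exact rcovers_runion _ _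
  cubesTopI D hD := by
    simp only [lower, lt_irrefl, if_false] at hD
    rcases hD with h | h
    exacts [Or.inl h, Or.inr h]
  subII m _ _ := rsub_refl _
  subIIp m _ _ p := rsub_refl _
  cubesII m _ _ D hD := hD
  subIII m hm _ := by simp only [lower, if_pos hm]; exact rsub_refl _
  subIIIp m hm _ p := by simp only [lower, if_pos hm]; exact rsub_refl _
  cubesIII m hm _ := by simp only [lower, if_pos hm]; exact subset_rfl
  upII hk := by
    have h1 : ¬ c.j + 2 ≤ c.j + 1 := by omega
    have h2 : ¬ c.j + 1 ≤ c.k₀ := by omega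
    simp only [lower, if_neg h1, if_neg h2]; exact rsub_refl _
  upIIp hk p := by
    have h1 : ¬ c.j + 2 ≤ c.j + 1 := by omega
    have h2 : ¬ c.j + 1 ≤ c.k₀ := by omega
    simp only [lower, if_neg h1, if_neg h2]; exact rsub_refl _
  cubesUpII hk := by
    have h1 : ¬ c.j + 2 ≤ c.j + 1 := by omega
    have h2 : ¬ c.j + 1 ≤ c.k₀ := by omega
    simp only [lower, if_neg h1, if_neg h2]; exact subset_rfl
  upI hk := by
    have h1 : ¬ c.j + 2 ≤ c.j + 1 := by omega
    simp only [lower, if_neg h1, if_pos hk]; exact rsub_refl _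
  upIp hk p := by
    have h1 : ¬ c.j + 2 ≤ c.j + 1 := by omega
    simp only [lower, if_neg h1, if_pos hk]; exact rsub_refl _
  cubesUpI hk := by
    have h1 : ¬ c.j + 2 ≤ c.j + 1 := by omega
    simp only [lower, if_neg h1, if_pos hk]; exact subset_rfl

end Lower

end

end Literature.MathematicalPhysics.QuantumFieldTheory.Balaban1983to89.B15Space164Descent
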